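import Summits.BirchSwinnertonDyer.BirchSwinnertonDyer.Theorems.ResidualThetaTransportAtTwoThetaLayerLambdaCongruenceAtTwoDoubling
import Summits.BirchSwinnertonDyer.BirchSwinnertonDyer.Theorems.ResidualThetaTransportAtTwoThetaLayerLambdaCongruenceAtTwoSupNormIsometry
import HarnessLib

/-!
# Crux `ThetaLayerLambdaCongruenceAtTwo` (stmt-BirchSwinnertonDyer-20688), line `birth` v4: the `μ`-DICTIONARY for stub (μ♮)
# `stub_depletedLayerMuTwo` — what `‖Θ^{S₀}_n(g;Ω)‖_sup = ‖2‖₂` means coefficient-wise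

Width seat bsd-wall-rtt-p3-w3 (`--supports stmt-BirchSwinnertonDyer-20688`; closes nothing). THEOREMS ONLY, route-independent
(no `Theses` import). Builds on the width seat w2's `…Doubling` (the `Δ = {±1}` doubling
`θ_n(g;Ω) = C 2 · ϑ_n`, `ϑ_n = ∑_{s mod 2ⁿ} [5ˢ/2ⁿ⁺²]⁺_{g,Ω} (X+1)^s`, and `‖Θ^{S₀}_n(g;Ω)‖_sup ≤ ‖2‖₂`) and on
`…SupNormIsometry` (`‖∑ c_t (X+1)^t‖_sup = max_t ‖c_t‖`).

## What is proved

* §1 REDUCTION SURVIVAL, both directions (complement of the landed `layerLambda_modByMonic_layerModulus`): for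
  `F ≠ 0` in `ℚ̄_p[X]`, `‖F %ₘ ω_n‖_sup = ‖F‖_sup ⟺ λ(F) < pⁿ` (`ω_n = (X+1)^{pⁿ} − 1`); if `λ(F) ≥ pⁿ` the reduction
  LOSES sup norm (`supNorm_modByMonic_lt_of_le_layerLambda`).
* §2 THE UNDEPLETED DICTIONARY at `p = 2`: at a cohomological period,
  `‖θ_n(g;Ω)^ι‖_sup = ‖2‖₂ ⟺ ∃ s, ‖ι [5ˢ/2ⁿ⁺²]⁺_{g,Ω}‖ = 1` — `μ(ϑ_n) = 0` iff SOME layer-`n` plus symbol is a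
  `2`-adic unit (`supNorm_map_mazurTateElementK_two_eq_norm_two_iff`).
* §3 THE DEPLETED DICTIONARY (the conclusion of (μ♮) at ONE layer `n`, verbatim the crux's element):
  `‖Θ^{S₀}_n(g;Ω)‖_sup = ‖2‖₂ ⟺ (∃ s, ‖ι [5ˢ/2ⁿ⁺²]⁺‖ = 1) ∧ ‖∏_{v∈S₀} E_v‖_sup = 1 ∧ λ(θ_n(g;Ω)^ι · ∏ E_v) < 2ⁿ`
  (`supNorm_depletedPartnerLayer_eq_norm_two_iff`), and THEN `λ(Θ^{S₀}_n(g;Ω)) = λ(θ_n(g;Ω)^ι) + λ(∏_{v∈S₀} E_v)`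
  (`layerLambda_depletedPartnerLayer_eq`; layer product rule p569921/p571920) — the bookkeeping
  «depleted λ = undepleted λ + Σ_v λ(E_v)» that D-rtt-1 observes numerically and that Kλ⁺/R1 uses.

So (μ♮) is, layer by layer, the conjunction of three checkable statements: a unit plus symbol at layer `n` (PW's `μ(ϑ_n) = 0`),
unit content of the Euler product, and the `λ`-room condition `λ < 2ⁿ`. Nothing about any curve or form is asserted; BSD is
not proved by any of this.

References: [PollackWeston2011MT] §2.1 (2.1), Def. 2.1, Rem. 2.2, §3.1; [GreenbergVatsal2000] §1 (imprimitive shift);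
[MazurTateTeitelbaum1986Invent] §I.13.
-/

noncomputable section

-- justification: the `Summit.BirchSwinnertonDyer.BirchSwinnertonDyer.…` path repeats a component (route-file convention)
set_option linter.dupNamespace false

open scoped Classical

open Polynomial

open Literature.NumberTheory.IwasawaTheory Literature.NumberTheory.EllipticCurves
  Literature.NumberTheory.EllipticCurves.ModularForms

namespace Summit.BirchSwinnertonDyer.BirchSwinnertonDyer.Theorems.ThetaLayerLambdaCongruenceAtTwo

/-! ## §1. Reduction modulo `ω_n` preserves the sup norm iff `λ < pⁿ` -/

section Survival

variable {K : Type*} [NormedField K]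

/-- If `m ≤ λ(F)` (`F ≠ 0`), the truncation of `F` below degree `m` has STRICTLY smaller sup norm than `F`: all its
coefficients sit before the index `λ(F)` where the maximum is first attained. [cite: PollackWeston2011MT, §3.1] -/
theorem supNorm_trunc_lt_of_le_layerLambda {F : K[X]} (hF : F ≠ 0) {m : ℕ} (hm : m ≤ layerLambda F) :
    (PowerSeries.trunc m (F : PowerSeries K)).supNorm < F.supNorm := by
  have hFpos : 0 < F.supNorm :=
    lt_of_le_of_ne (supNorm_nonneg F) (Ne.symm ((supNorm_eq_zero_iff F).not.mpr hF))
  obtain ⟨i, hi⟩ := (PowerSeries.trunc m (F : PowerSeries K)).exists_eq_supNorm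
  rw [hi, PowerSeries.coeff_trunc]
  split_ifs with him
  · rw [Polynomial.coeff_coe]
    exact norm_coeff_lt_supNorm_of_lt_layerLambda (lt_of_lt_of_le him hm)
  · rw [norm_zero]
    exact hFpos

variable [IsUltrametricDist K]

/-- **Reduction modulo `ω` LOSES sup norm when `λ(F) ≥ deg ω`** (`ω` monic, integral, `‖ω − X^m‖_sup < 1`, `F ≠ 0`):
`‖F %ₘ ω‖_sup < ‖F‖_sup` — the remainder is the truncation (small by `supNorm_trunc_lt_of_le_layerLambda`) plus an
error of size `≤ ‖ω − X^m‖_sup·‖F‖_sup < ‖F‖_sup` (`supNorm_modByMonic_sub_trunc_le`). [cite: PollackWeston2011MT, §3.1] -/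
theorem supNorm_modByMonic_lt_of_le_layerLambda {ω : K[X]} (hω : ω.Monic) (hω1 : ω.supNorm ≤ 1)
    (hlt : (ω - X ^ ω.natDegree).supNorm < 1) {F : K[X]} (hF : F ≠ 0) (hm : ω.natDegree ≤ layerLambda F) :
    (F %ₘ ω).supNorm < F.supNorm := by
  have hFpos : 0 < F.supNorm :=
    lt_of_le_of_ne (supNorm_nonneg F) (Ne.symm ((supNorm_eq_zero_iff F).not.mpr hF))
  set T := PowerSeries.trunc ω.natDegree (F : PowerSeries K) with hT
  have hdec : F %ₘ ω = (F %ₘ ω - T) + T := by abel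
  rw [hdec]
  refine (supNorm_add_le_max _ _).trans_lt (max_lt ?_ (supNorm_trunc_lt_of_le_layerLambda hF hm))
  refine (supNorm_modByMonic_sub_trunc_le hω hω1 le_rfl F).trans_lt ?_
  calc (ω - X ^ ω.natDegree).supNorm * F.supNorm < 1 * F.supNorm := mul_lt_mul_of_pos_right hlt hFpos
    _ = F.supNorm := one_mul _

/-- **Reduction survival, both directions**: over `ℚ̄_p`, for `F ≠ 0`, `‖F %ₘ ω_n‖_sup = ‖F‖_sup ⟺ λ(F) < pⁿ`
(`ω_n = (X+1)^{pⁿ} − 1`; `⟸` is the landed `layerLambda_modByMonic_layerModulus`, `⟹` is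
`supNorm_modByMonic_lt_of_le_layerLambda`). [cite: PollackWeston2011MT, §3.1] -/
theorem supNorm_modByMonic_layerModulus_eq_iff {p : ℕ} [Fact p.Prime] (n : ℕ) {F : (PadicAlgCl p)[X]}
    (hF : F ≠ 0) : (F %ₘ ((X + 1) ^ p ^ n - 1)).supNorm = F.supNorm ↔ layerLambda F < p ^ n := by
  constructor
  · intro h
    by_contra hge
    have hlt := supNorm_modByMonic_lt_of_le_layerLambda (monic_layerModulus n) (supNorm_layerModulus_le_one n)
      (supNorm_layerModulus_sub_X_pow_lt_one n) hF (by rw [natDegree_layerModulus]; exact not_lt.mp hge)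
    exact hlt.ne h
  · intro h
    exact (layerLambda_modByMonic_layerModulus n hF h).1

end Survival

/-! ## §2. The undepleted dictionary at `p = 2`: `‖θ_n(g;Ω)^ι‖_sup = ‖2‖` iff a layer-`n` plus symbol is a unit -/

section Dictionary

variable {M : ℕ} [NeZero M] {g : CuspForm (CongruenceSubgroup.Gamma0 M) 2}
  (ι : coeffField g →+* PadicAlgCl 2) (Ω : ℂ)

/-- `θ_n(g;Ω)^ι = C 2 · ∑_{s mod 2ⁿ} C(ι[5ˢ/2ⁿ⁺²]⁺)·(X+1)^s` in `ℚ̄₂[X]` (the doubling `mazurTateElementK_two` read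
through `ι`). [cite: MazurTateTeitelbaum1986Invent, §I.13] -/
theorem map_mazurTateElementK_two (n : ℕ) :
    ((Literature.NumberTheory.EllipticCurves.mazurTateElementK g Ω 2 n).map ι) = C (2 : PadicAlgCl 2) * ∑ s : ZMod (2 ^ n),
      C (ι (plusSymbolK g Ω (((((cyclotomicGenerator 2 : ZMod (2 ^ (n + 2))) ^ s.val).val : ℕ) : ℚ) / (2 : ℚ) ^ (n + 2)))) * (X + 1) ^ s.val := by
  rw [mazurTateElementK_two, Polynomial.map_mul, Polynomial.map_C, map_ofNat, Polynomial.map_sum]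
  congr 1
  refine Finset.sum_congr rfl fun s _ ↦ ?_
  rw [Polynomial.map_mul, Polynomial.map_pow, Polynomial.map_add, Polynomial.map_X, Polynomial.map_one, map_C]

/-- `‖θ_n(g;Ω)^ι‖_sup = ‖2‖₂ · ‖∑ C(ι[5ˢ/2ⁿ⁺²]⁺)·(X+1)^s‖_sup`. [cite: MazurTateTeitelbaum1986Invent, §I.13] -/
theorem supNorm_map_mazurTateElementK_two_eq (n : ℕ) :
    ((Literature.NumberTheory.EllipticCurves.mazurTateElementK g Ω 2 n).map ι).supNorm = ‖(2 : PadicAlgCl 2)‖ * (∑ s : ZMod (2 ^ n),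
      C (ι (plusSymbolK g Ω (((((cyclotomicGenerator 2 : ZMod (2 ^ (n + 2))) ^ s.val).val : ℕ) : ℚ) / (2 : ℚ) ^ (n + 2)))) * (X + 1) ^ s.val).supNorm := by
  rw [map_mazurTateElementK_two, supNorm_C_mul]

variable {ι Ω}

/-- **The `μ`-dictionary at `p = 2` (undepleted).** At a COHOMOLOGICAL plus period `Ω` of `g` along `ι`,
`‖θ_n(g;Ω)^ι‖_sup = ‖2‖₂` — i.e. the single-count element `ϑ_n = ∑ [5ˢ/2ⁿ⁺²]⁺ (X+1)^s` has `μ(ϑ_n) = 0` — iff SOME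
layer-`n` plus symbol `ι[5ˢ/2ⁿ⁺²]⁺_{g,Ω}` is a `2`-adic unit (all of them are integral, PW Def. 2.1; the sup norm of
`∑ c_s (X+1)^s` is `max_s ‖c_s‖`, `…SupNormIsometry`). [cite: PollackWeston2011MT, Def. 2.1 and §3.1] -/
theorem supNorm_map_mazurTateElementK_two_eq_norm_two_iff (h : IsCohomologicalPlusPeriod g ι Ω) (n : ℕ) :
    ((Literature.NumberTheory.EllipticCurves.mazurTateElementK g Ω 2 n).map ι).supNorm = ‖(2 : PadicAlgCl 2)‖ ↔
      ∃ s : ZMod (2 ^ n), ‖ι (plusSymbolK g Ω (((((cyclotomicGenerator 2 : ZMod (2 ^ (n + 2))) ^ s.val).val : ℕ) : ℚ) / (2 : ℚ) ^ (n + 2)))‖ = 1 := by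
  haveI : NeZero (2 ^ n) := ⟨pow_ne_zero _ two_ne_zero⟩
  rw [supNorm_map_mazurTateElementK_two_eq]
  set c : ZMod (2 ^ n) → PadicAlgCl 2 := fun s ↦ ι (plusSymbolK g Ω (((((cyclotomicGenerator 2 : ZMod (2 ^ (n + 2))) ^ s.val).val : ℕ) : ℚ) / (2 : ℚ) ^ (n + 2))) with hc
  have hS : (∑ s : ZMod (2 ^ n), C (ι (plusSymbolK g Ω (((((cyclotomicGenerator 2 : ZMod (2 ^ (n + 2))) ^ s.val).val : ℕ) : ℚ) / (2 : ℚ) ^ (n + 2)))) * (X + 1) ^ s.val) =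
      ∑ s : ZMod (2 ^ n), C (c s) * (X + 1) ^ s.val := by
    simp only [hc]
  rw [hS]
  have h2 : (0 : ℝ) < ‖(2 : PadicAlgCl 2)‖ := norm_pos_iff.mpr two_ne_zero
  have hle : (∑ s : ZMod (2 ^ n), C (c s) * (X + 1) ^ s.val).supNorm ≤ 1 :=
    (supNorm_sum_C_mul_X_add_one_pow_le_iff c zero_le_one).mpr fun t ↦ h.norm_le_one _
  constructor
  · intro heq
    have h1 : (∑ s : ZMod (2 ^ n), C (c s) * (X + 1) ^ s.val).supNorm = 1 :=
      mul_left_cancel₀ h2.ne' (heq.trans (mul_one _).symm)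
    obtain ⟨s, hs⟩ := exists_supNorm_sum_C_mul_X_add_one_pow_eq c
    exact ⟨s, by rw [← hs, h1]⟩
  · rintro ⟨s, hs⟩
    have hge : 1 ≤ (∑ s : ZMod (2 ^ n), C (c s) * (X + 1) ^ s.val).supNorm :=
      hs ▸ norm_le_supNorm_sum_C_mul_X_add_one_pow c s
    rw [le_antisymm hle hge, mul_one]

/-! ## §3. The depleted dictionary: the conclusion of (μ♮) at one layer, coefficient-wise -/

/-- Squeezing a product: `a ≤ A`, `b ≤ 1`, `0 ≤ a`, `0 < A` and `a·b = A` force `a = A` and `b = 1`. [folklore] -/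
private theorem eq_and_eq_of_mul_eq {a b A : ℝ} (ha : a ≤ A) (hb : b ≤ 1) (ha0 : 0 ≤ a) (hA : 0 < A)
    (h : a * b = A) : a = A ∧ b = 1 := by
  have h1 : a = A := by
    by_contra hne
    have hlt : a < A := lt_of_le_of_ne ha hne
    have : a * b < A := by
      calc a * b ≤ a * 1 := mul_le_mul_of_nonneg_left hb ha0
        _ = a := mul_one a
        _ < A := hlt
    exact this.ne h
  refine ⟨h1, ?_⟩
  rw [h1] at h
  have := mul_left_cancel₀ hA.ne' (h.trans (mul_one A).symm)
  exact this

/-- **The depleted `μ`-dictionary at `p = 2`** — the conclusion of stub (μ♮) `stub_depletedLayerMuTwo` at ONE layer `n`,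
unfolded: for a newform `g` on `Γ₀(M)`, a cohomological plus period `Ω` along `ι`, and `S₀` off `2`,
`‖Θ^{S₀}_n(g;Ω)‖_sup = ‖2‖₂` iff (a) SOME layer-`n` plus symbol `ι[5ˢ/2ⁿ⁺²]⁺` is a unit (`μ(ϑ_n) = 0`), (b) the Euler
product `∏_{v∈S₀} E_v` has unit sup norm, and (c) `λ(θ_n(g;Ω)^ι · ∏ E_v) < 2ⁿ` (room below the degree of `ω_n`).
PROOF: `‖Θ‖ ≤ ‖θ^ι‖·‖∏E_v‖ ≤ ‖2‖·1` (landed); equality squeezes both factors and forces the reduction modulo `ω_n` to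
preserve the sup norm, i.e. `λ < 2ⁿ` (§1); conversely (a)(b)(c) give `‖θ^ι ∏E_v‖ = ‖2‖ ≠ 0` and survival.
[cite: PollackWeston2011MT, §3.1 (layer invariants; shape)] -/
theorem supNorm_depletedPartnerLayer_eq_norm_two_iff (hg : IsNewform0 g) (h : IsCohomologicalPlusPeriod g ι Ω)
    (S₀ : Finset (IsDedekindDomain.HeightOneSpectrum (NumberField.RingOfIntegers ℚ)))
    (hS2 : ∀ v ∈ S₀, ((2 : ℕ) : NumberField.RingOfIntegers ℚ) ∉ v.asIdeal) (n : ℕ) :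
    (((Literature.NumberTheory.EllipticCurves.mazurTateElementK g Ω 2 n).map ι * ∏ v ∈ S₀, (1 - Polynomial.C (Literature.NumberTheory.EllipticCurves.embCoeff g ι (Rat.HeightOneSpectrum.natGenerator v)) * Polynomial.X + (if Rat.HeightOneSpectrum.natGenerator v ∣ M then 0 else Polynomial.C (Rat.HeightOneSpectrum.natGenerator v : PadicAlgCl 2)) * Polynomial.X ^ 2).comp (Polynomial.C ((Rat.HeightOneSpectrum.natGenerator v : PadicAlgCl 2)⁻¹) * (Polynomial.X + 1) ^ (PadicInt.toZModPow n (-(Literature.NumberTheory.EllipticCurves.GreenbergVatsal2000.frobeniusExponent 2 (Rat.HeightOneSpectrum.natGenerator v : ℤ_[2])))).val)) %ₘ ((Polynomial.X + 1) ^ 2 ^ n - 1)).supNorm = ‖(2 : PadicAlgCl 2)‖ ↔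
      (∃ s : ZMod (2 ^ n), ‖ι (plusSymbolK g Ω (((((cyclotomicGenerator 2 : ZMod (2 ^ (n + 2))) ^ s.val).val : ℕ) : ℚ) / (2 : ℚ) ^ (n + 2)))‖ = 1) ∧
        (∏ v ∈ S₀, (1 - Polynomial.C (Literature.NumberTheory.EllipticCurves.embCoeff g ι (Rat.HeightOneSpectrum.natGenerator v)) * Polynomial.X + (if Rat.HeightOneSpectrum.natGenerator v ∣ M then 0 else Polynomial.C (Rat.HeightOneSpectrum.natGenerator v : PadicAlgCl 2)) * Polynomial.X ^ 2).comp (Polynomial.C ((Rat.HeightOneSpectrum.natGenerator v : PadicAlgCl 2)⁻¹) * (Polynomial.X + 1) ^ (PadicInt.toZModPow n (-(Literature.NumberTheory.EllipticCurves.GreenbergVatsal2000.frobeniusExponent 2 (Rat.HeightOneSpectrum.natGenerator v : ℤ_[2])))).val)).supNorm = 1 ∧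
        layerLambda (((Literature.NumberTheory.EllipticCurves.mazurTateElementK g Ω 2 n).map ι) * ∏ v ∈ S₀, (1 - Polynomial.C (Literature.NumberTheory.EllipticCurves.embCoeff g ι (Rat.HeightOneSpectrum.natGenerator v)) * Polynomial.X + (if Rat.HeightOneSpectrum.natGenerator v ∣ M then 0 else Polynomial.C (Rat.HeightOneSpectrum.natGenerator v : PadicAlgCl 2)) * Polynomial.X ^ 2).comp (Polynomial.C ((Rat.HeightOneSpectrum.natGenerator v : PadicAlgCl 2)⁻¹) * (Polynomial.X + 1) ^ (PadicInt.toZModPow n (-(Literature.NumberTheory.EllipticCurves.GreenbergVatsal2000.frobeniusExponent 2 (Rat.HeightOneSpectrum.natGenerator v : ℤ_[2])))).val)) < 2 ^ n := by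
  have h2 : (0 : ℝ) < ‖(2 : PadicAlgCl 2)‖ := norm_pos_iff.mpr two_ne_zero
  have hA : ((Literature.NumberTheory.EllipticCurves.mazurTateElementK g Ω 2 n).map ι).supNorm ≤ ‖(2 : PadicAlgCl 2)‖ := supNorm_map_mazurTateElementK_two_le h n
  have hE : (∏ v ∈ S₀, (1 - Polynomial.C (Literature.NumberTheory.EllipticCurves.embCoeff g ι (Rat.HeightOneSpectrum.natGenerator v)) * Polynomial.X + (if Rat.HeightOneSpectrum.natGenerator v ∣ M then 0 else Polynomial.C (Rat.HeightOneSpectrum.natGenerator v : PadicAlgCl 2)) * Polynomial.X ^ 2).comp (Polynomial.C ((Rat.HeightOneSpectrum.natGenerator v : PadicAlgCl 2)⁻¹) * (Polynomial.X + 1) ^ (PadicInt.toZModPow n (-(Literature.NumberTheory.EllipticCurves.GreenbergVatsal2000.frobeniusExponent 2 (Rat.HeightOneSpectrum.natGenerator v : ℤ_[2])))).val)).supNorm ≤ 1 :=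
    supNorm_prod_le_one _ _ fun v hv ↦
      supNorm_partnerEulerFactor_le_one hg ι M (not_two_dvd_natGenerator (hS2 v hv)) _
  rw [← supNorm_map_mazurTateElementK_two_eq_norm_two_iff h n]
  constructor
  · intro hΘ
    -- squeeze: ‖2‖ = ‖Θ‖ ≤ ‖θ E‖ = ‖θ‖‖E‖ ≤ ‖2‖
    have hle1 : ‖(2 : PadicAlgCl 2)‖ ≤ (((Literature.NumberTheory.EllipticCurves.mazurTateElementK g Ω 2 n).map ι) * ∏ v ∈ S₀, (1 - Polynomial.C (Literature.NumberTheory.EllipticCurves.embCoeff g ι (Rat.HeightOneSpectrum.natGenerator v)) * Polynomial.X + (if Rat.HeightOneSpectrum.natGenerator v ∣ M then 0 else Polynomial.C (Rat.HeightOneSpectrum.natGenerator v : PadicAlgCl 2)) * Polynomial.X ^ 2).comp (Polynomial.C ((Rat.HeightOneSpectrum.natGenerator v : PadicAlgCl 2)⁻¹) * (Polynomial.X + 1) ^ (PadicInt.toZModPow n (-(Literature.NumberTheory.EllipticCurves.GreenbergVatsal2000.frobeniusExponent 2 (Rat.HeightOneSpectrum.natGenerator v : ℤ_[2])))).val)).supNorm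 := by
      rw [← hΘ]
      exact supNorm_modByMonic_le (monic_layerModulus (p := 2) n) (supNorm_layerModulus_le_one (p := 2) n) _
    have hprod : (((Literature.NumberTheory.EllipticCurves.mazurTateElementK g Ω 2 n).map ι) * ∏ v ∈ S₀, (1 - Polynomial.C (Literature.NumberTheory.EllipticCurves.embCoeff g ι (Rat.HeightOneSpectrum.natGenerator v)) * Polynomial.X + (if Rat.HeightOneSpectrum.natGenerator v ∣ M then 0 else Polynomial.C (Rat.HeightOneSpectrum.natGenerator v : PadicAlgCl 2)) * Polynomial.X ^ 2).comp (Polynomial.C ((Rat.HeightOneSpectrum.natGenerator v : PadicAlgCl 2)⁻¹) * (Polynomial.X + 1) ^ (PadicInt.toZModPow n (-(Literature.NumberTheory.EllipticCurves.GreenbergVatsal2000.frobeniusExponent 2 (Rat.HeightOneSpectrum.natGenerator v : ℤ_[2])))).val)).supNorm = ‖(2 : PadicAlgCl 2)‖ := by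
      refine le_antisymm ?_ hle1
      rw [supNorm_mul']
      calc _ ≤ ‖(2 : PadicAlgCl 2)‖ * 1 := mul_le_mul hA hE (supNorm_nonneg _) h2.le
        _ = _ := mul_one _
    have hsq := eq_and_eq_of_mul_eq hA hE (supNorm_nonneg _) h2
      ((supNorm_mul' _ _).symm.trans hprod)
    have hF : ((Literature.NumberTheory.EllipticCurves.mazurTateElementK g Ω 2 n).map ι) * ∏ v ∈ S₀, (1 - Polynomial.C (Literature.NumberTheory.EllipticCurves.embCoeff g ι (Rat.HeightOneSpectrum.natGenerator v)) * Polynomial.X + (if Rat.HeightOneSpectrum.natGenerator v ∣ M then 0 else Polynomial.C (Rat.HeightOneSpectrum.natGenerator v : PadicAlgCl 2)) * Polynomial.X ^ 2).comp (Polynomial.C ((Rat.HeightOneSpectrum.natGenerator v : PadicAlgCl 2)⁻¹) * (Polynomial.X + 1) ^ (PadicInt.toZModPow n (-(Literature.NumberTheory.EllipticCurves.GreenbergVatsal2000.frobeniusExponent 2 (Rat.HeightOneSpectrum.natGenerator v : ℤ_[2])))).val) ≠ 0 := fun h0 ↦ by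
      rw [h0, supNorm_zero] at hprod
      exact h2.ne hprod
    refine ⟨hsq.1, hsq.2, (supNorm_modByMonic_layerModulus_eq_iff (p := 2) n hF).mp ?_⟩
    rw [hΘ, hprod]
  · rintro ⟨hθ, hEu, hlam⟩
    have hprod : (((Literature.NumberTheory.EllipticCurves.mazurTateElementK g Ω 2 n).map ι) * ∏ v ∈ S₀, (1 - Polynomial.C (Literature.NumberTheory.EllipticCurves.embCoeff g ι (Rat.HeightOneSpectrum.natGenerator v)) * Polynomial.X + (if Rat.HeightOneSpectrum.natGenerator v ∣ M then 0 else Polynomial.C (Rat.HeightOneSpectrum.natGenerator v : PadicAlgCl 2)) * Polynomial.X ^ 2).comp (Polynomial.C ((Rat.HeightOneSpectrum.natGenerator v : PadicAlgCl 2)⁻¹) * (Polynomial.X + 1) ^ (PadicInt.toZModPow n (-(Literature.NumberTheory.EllipticCurves.GreenbergVatsal2000.frobeniusExponent 2 (Rat.HeightOneSpectrum.natGenerator v : ℤ_[2])))).val)).supNorm = ‖(2 : PadicAlgCl 2)‖ := by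
      rw [supNorm_mul', hθ, hEu, mul_one]
    have hF : ((Literature.NumberTheory.EllipticCurves.mazurTateElementK g Ω 2 n).map ι) * ∏ v ∈ S₀, (1 - Polynomial.C (Literature.NumberTheory.EllipticCurves.embCoeff g ι (Rat.HeightOneSpectrum.natGenerator v)) * Polynomial.X + (if Rat.HeightOneSpectrum.natGenerator v ∣ M then 0 else Polynomial.C (Rat.HeightOneSpectrum.natGenerator v : PadicAlgCl 2)) * Polynomial.X ^ 2).comp (Polynomial.C ((Rat.HeightOneSpectrum.natGenerator v : PadicAlgCl 2)⁻¹) * (Polynomial.X + 1) ^ (PadicInt.toZModPow n (-(Literature.NumberTheory.EllipticCurves.GreenbergVatsal2000.frobeniusExponent 2 (Rat.HeightOneSpectrum.natGenerator v : ℤ_[2])))).val) ≠ 0 := fun h0 ↦ by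
      rw [h0, supNorm_zero] at hprod
      exact h2.ne hprod
    rw [(supNorm_modByMonic_layerModulus_eq_iff (p := 2) n hF).mpr hlam, hprod]

/-- **`λ` of the depleted partner element when (μ♮) holds at layer `n`**: if `‖Θ^{S₀}_n(g;Ω)‖_sup = ‖2‖₂` then
`λ(Θ^{S₀}_n(g;Ω)) = λ(θ_n(g;Ω)^ι) + λ(∏_{v∈S₀} E_v)` — the layer product rule (landed, p569921/p571920) in the situation
where it applies («depleted λ = undepleted λ + Σ d_v», the law D-rtt-1 measures). [cite: GreenbergVatsal2000, §1 (imprimitive λ-shift; shape)] -/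
theorem layerLambda_depletedPartnerLayer_eq (hg : IsNewform0 g) (h : IsCohomologicalPlusPeriod g ι Ω)
    (S₀ : Finset (IsDedekindDomain.HeightOneSpectrum (NumberField.RingOfIntegers ℚ)))
    (hS2 : ∀ v ∈ S₀, ((2 : ℕ) : NumberField.RingOfIntegers ℚ) ∉ v.asIdeal) (n : ℕ)
    (hμ : (((Literature.NumberTheory.EllipticCurves.mazurTateElementK g Ω 2 n).map ι * ∏ v ∈ S₀, (1 - Polynomial.C (Literature.NumberTheory.EllipticCurves.embCoeff g ι (Rat.HeightOneSpectrum.natGenerator v)) * Polynomial.X + (if Rat.HeightOneSpectrum.natGenerator v ∣ M then 0 else Polynomial.C (Rat.HeightOneSpectrum.natGenerator v : PadicAlgCl 2)) * Polynomial.X ^ 2).comp (Polynomial.C ((Rat.HeightOneSpectrum.natGenerator v : PadicAlgCl 2)⁻¹) * (Polynomial.X + 1) ^ (PadicInt.toZModPow n (-(Literature.NumberTheory.EllipticCurves.GreenbergVatsal2000.frobeniusExponent 2 (Rat.HeightOneSpectrum.natGenerator v : ℤ_[2])))).val)) %ₘ ((Polynomial.X + 1) ^ 2 ^ n - 1)).supNorm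 = ‖(2 : PadicAlgCl 2)‖) :
    layerLambda (((Literature.NumberTheory.EllipticCurves.mazurTateElementK g Ω 2 n).map ι * ∏ v ∈ S₀, (1 - Polynomial.C (Literature.NumberTheory.EllipticCurves.embCoeff g ι (Rat.HeightOneSpectrum.natGenerator v)) * Polynomial.X + (if Rat.HeightOneSpectrum.natGenerator v ∣ M then 0 else Polynomial.C (Rat.HeightOneSpectrum.natGenerator v : PadicAlgCl 2)) * Polynomial.X ^ 2).comp (Polynomial.C ((Rat.HeightOneSpectrum.natGenerator v : PadicAlgCl 2)⁻¹) * (Polynomial.X + 1) ^ (PadicInt.toZModPow n (-(Literature.NumberTheory.EllipticCurves.GreenbergVatsal2000.frobeniusExponent 2 (Rat.HeightOneSpectrum.natGenerator v : ℤ_[2])))).val)) %ₘ ((Polynomial.X + 1) ^ 2 ^ n - 1)) = layerLambda ((Literature.NumberTheory.EllipticCurves.mazurTateElementK g Ω 2 n).map ι) + layerLambda (∏ v ∈ S₀, (1 - Polynomial.C (Literature.NumberTheory.EllipticCurves.embCoeff g ι (Rat.HeightOneSpectrum.natGenerator v)) * Polynomial.X + (if Rat.HeightOneSpectrum.natGenerator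 v ∣ M then 0 else Polynomial.C (Rat.HeightOneSpectrum.natGenerator v : PadicAlgCl 2)) * Polynomial.X ^ 2).comp (Polynomial.C ((Rat.HeightOneSpectrum.natGenerator v : PadicAlgCl 2)⁻¹) * (Polynomial.X + 1) ^ (PadicInt.toZModPow n (-(Literature.NumberTheory.EllipticCurves.GreenbergVatsal2000.frobeniusExponent 2 (Rat.HeightOneSpectrum.natGenerator v : ℤ_[2])))).val)) := by
  obtain ⟨hθ, hEu, hlam⟩ := (supNorm_depletedPartnerLayer_eq_norm_two_iff hg h S₀ hS2 n).mp hμ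
  have h2 : (0 : ℝ) < ‖(2 : PadicAlgCl 2)‖ := norm_pos_iff.mpr two_ne_zero
  have hθn : ((Literature.NumberTheory.EllipticCurves.mazurTateElementK g Ω 2 n).map ι).supNorm = ‖(2 : PadicAlgCl 2)‖ :=
    (supNorm_map_mazurTateElementK_two_eq_norm_two_iff h n).mpr hθ
  have hθ0 : ((Literature.NumberTheory.EllipticCurves.mazurTateElementK g Ω 2 n).map ι) ≠ 0 := fun h0 ↦ by
    rw [h0, supNorm_zero] at hθn
    exact h2.ne hθn
  have hE0 : ∏ v ∈ S₀, (1 - Polynomial.C (Literature.NumberTheory.EllipticCurves.embCoeff g ι (Rat.HeightOneSpectrum.natGenerator v)) * Polynomial.X + (if Rat.HeightOneSpectrum.natGenerator v ∣ M then 0 else Polynomial.C (Rat.HeightOneSpectrum.natGenerator v : PadicAlgCl 2)) * Polynomial.X ^ 2).comp (Polynomial.C ((Rat.HeightOneSpectrum.natGenerator v : PadicAlgCl 2)⁻¹) * (Polynomial.X + 1) ^ (PadicInt.toZModPow n (-(Literature.NumberTheory.EllipticCurves.GreenbergVatsal2000.frobeniusExponent 2 (Rat.HeightOneSpectrum.natGenerator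 v : ℤ_[2])))).val) ≠ 0 := fun h0 ↦ by
    rw [h0, supNorm_zero] at hEu
    exact zero_ne_one hEu
  rw [layerLambda_mul hθ0 hE0] at hlam
  exact (layerLambda_mul_modByMonic_layerModulus n hθ0 hE0 hlam).1

end Dictionary

end Summit.BirchSwinnertonDyer.BirchSwinnertonDyer.Theorems.ThetaLayerLambdaCongruenceAtTwo

end
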